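import Mathlib.Analysis.Calculus.Taylor
import Mathlib.Analysis.Calculus.FDeriv.Analytic
import Mathlib.Analysis.Analytic.Constructions
import Literature.NumberTheory.Transcendental.SemialgebraicLineDeriv
import Summits.KontsevichZagierPeriods.KontsevichZagierPeriods.Theorems.ValuedFieldSpecialisationClassLevelExpansionFibreDimOneToolkit

/-!
# Route ValuedFieldSpecialisation — Taylor expansion in the parameter with uniform remainder

Helper for item stmt-KontsevichZagierPeriods-3503 (`ClassLevelExpansionFibreDimOne`). The
class-level expansion of a prepared family repeatedly expands a function `G(t, x)` — real-analytic
and `ℚ`-semialgebraic (Nash) on an open set `O ⊆ ℝ × ℝᵐ`, coordinates `z = vecCons t x` — in powers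
of the parameter `t = z 0` with coefficients depending on `x` and a remainder bounded UNIFORMLY
for `x` in a compact set:

  `|G(t, x) − Σ_{k ≤ K} (k!)⁻¹ tᵏ (∂₀ᵏ G)(0, x)| ≤ C t^{K+1}`   (`0 ≤ t ≤ δ₀`, `x ∈ P`).

Here `∂₀ᵏ G = (f ↦ (z ↦ fderiv ℝ f z e₀))^[k] G` is the `k`-fold derivative in the direction
`e₀ = Pi.single 0 1` (written with `Function.iterate`, no new definition). Main statements:

* `analyticOnNhd_iterate_dirDeriv`, `isSemialgebraicFunOn_iterate_dirDeriv` — `∂₀ᵏ G` is again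
  analytic and `ℚ`-semialgebraic on `O` (partial derivatives of semialgebraic functions,
  `IsSemialgebraicFunOn.fderiv_apply_single`);
* `iteratedDeriv_slice` — the iterated derivative of the slice `t ↦ G (vecCons t x)` is the slice
  of `∂₀ᵏ G`;
* `exists_taylor_bound_slice` — the uniform Taylor bound above (`taylor_mean_remainder_bound` on
  each slice, the `(K+1)`-st directional derivative being bounded on the compact set of slices);
* `isSemialgebraicFunOn_dirDeriv_coeff`, `continuousOn_dirDeriv_coeff` — the coefficient functions
  `x ↦ (∂₀ᵏ G)(vecCons 0 x)` are `ℚ`-semialgebraic and continuous.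

Sources: folklore real analysis (Taylor–Lagrange); Bochnak–Coste–Roy 1998, §2.9 (derivatives of
Nash functions are Nash). Deliberately NOT here: any integral representation.
-/

noncomputable section

namespace Summit.KontsevichZagierPeriods.ValuedFieldSpecialisation

open Set Filter Function
open scoped Topology
open Literature.NumberTheory.Transcendental
open Literature.ModelTheory.ExponentialFields (IsSemialgebraic)

variable {m : ℕ}

/-! ### Slices along the parameter coordinate -/

/-- `vecCons t x = t • e₀ + vecCons 0 x`. [folklore] -/
theorem vecCons_eq_smul_add (t : ℝ) (x : Fin m → ℝ) :
    (Matrix.vecCons t x : Fin (m + 1) → ℝ) =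
      t • (Pi.single 0 1 : Fin (m + 1) → ℝ) + Matrix.vecCons 0 x := by
  ext i
  refine Fin.cases ?_ (fun j => ?_) i
  · simp
  · simp [Fin.succ_ne_zero]

/-- The slice map `t ↦ vecCons t x` has derivative `e₀`. [folklore] -/
theorem hasDerivAt_vecCons (x : Fin m → ℝ) (t : ℝ) :
    HasDerivAt (fun τ : ℝ => (Matrix.vecCons τ x : Fin (m + 1) → ℝ)) (Pi.single 0 1) t := by
  have h : HasDerivAt (fun τ : ℝ => τ • (Pi.single 0 1 : Fin (m + 1) → ℝ) + Matrix.vecCons 0 x)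
      ((1 : ℝ) • (Pi.single 0 1 : Fin (m + 1) → ℝ)) t :=
    ((hasDerivAt_id t).smul_const _).add_const _
  rw [one_smul] at h
  exact h.congr_of_eventuallyEq (Eventually.of_forall fun τ => vecCons_eq_smul_add τ x)

/-- The slice map is analytic. [folklore] -/
theorem analyticAt_vecCons_slice (x : Fin m → ℝ) (t : ℝ) :
    AnalyticAt ℝ (fun τ : ℝ => (Matrix.vecCons τ x : Fin (m + 1) → ℝ)) t := by
  have : (fun τ : ℝ => (Matrix.vecCons τ x : Fin (m + 1) → ℝ)) =
      fun τ => τ • (Pi.single 0 1 : Fin (m + 1) → ℝ) + Matrix.vecCons 0 x :=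
    funext fun τ => vecCons_eq_smul_add τ x
  rw [this]
  exact (analyticAt_id.smul analyticAt_const).add analyticAt_const

/-- The two-variable map `(t, x) ↦ vecCons t x` is continuous. [folklore] -/
theorem continuous_vecCons₂ :
    Continuous fun p : ℝ × (Fin m → ℝ) => (Matrix.vecCons p.1 p.2 : Fin (m + 1) → ℝ) := by
  refine continuous_pi fun i => ?_
  refine Fin.cases ?_ (fun j => ?_) i
  · simpa using continuous_fst
  · have h : Continuous fun a : ℝ × (Fin m → ℝ) => a.2 j :=
      (continuous_apply j).comp continuous_snd
    simpa using h

/-! ### Iterated directional derivatives `∂₀ᵏ G` -/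

/-- `∂₀ᵏ G` is analytic on `O` if `G` is. [folklore] -/
theorem analyticOnNhd_iterate_dirDeriv {O : Set (Fin (m + 1) → ℝ)} {G : (Fin (m + 1) → ℝ) → ℝ}
    (hG : AnalyticOnNhd ℝ G O) (k : ℕ) :
    AnalyticOnNhd ℝ
      ((fun f : (Fin (m + 1) → ℝ) → ℝ => fun z => fderiv ℝ f z (Pi.single 0 1))^[k] G) O := by
  induction k with
  | zero => simpa using hG
  | succ k ih =>
    intro z hz
    rw [iterate_succ']
    exact ((ContinuousLinearMap.apply ℝ ℝ (Pi.single (0 : Fin (m + 1)) (1 : ℝ))).analyticAt _).comp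
      (ih z hz).fderiv

/-- `∂₀ᵏ G` is `ℚ`-semialgebraic on the open set `O` if `G` is analytic and `ℚ`-semialgebraic
there (partial derivatives of semialgebraic functions are semialgebraic,
`IsSemialgebraicFunOn.fderiv_apply_single`). [Bochnak–Coste–Roy 1998, §2.9] [folklore] -/
theorem isSemialgebraicFunOn_iterate_dirDeriv {O : Set (Fin (m + 1) → ℝ)}
    {G : (Fin (m + 1) → ℝ) → ℝ} (hO : IsOpen O) (hG : AnalyticOnNhd ℝ G O)
    (hsa : IsSemialgebraicFunOn ℚ O G) (k : ℕ) :
    IsSemialgebraicFunOn ℚ O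
      ((fun f : (Fin (m + 1) → ℝ) → ℝ => fun z => fderiv ℝ f z (Pi.single 0 1))^[k] G) := by
  induction k with
  | zero => simpa using hsa
  | succ k ih =>
    rw [iterate_succ']
    exact ih.fderiv_apply_single hO
      (fun z hz => (analyticOnNhd_iterate_dirDeriv hG k z hz).differentiableAt) 0

/-- The slice of `∂₀ᵏ G` has derivative the slice of `∂₀^{k+1} G`. [folklore] -/
theorem hasDerivAt_iterate_dirDeriv_slice {O : Set (Fin (m + 1) → ℝ)} {G : (Fin (m + 1) → ℝ) → ℝ}
    (hG : AnalyticOnNhd ℝ G O) (k : ℕ) (x : Fin m → ℝ) {t : ℝ}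
    (ht : (Matrix.vecCons t x : Fin (m + 1) → ℝ) ∈ O) :
    HasDerivAt (fun τ : ℝ =>
      ((fun f : (Fin (m + 1) → ℝ) → ℝ => fun z => fderiv ℝ f z (Pi.single 0 1))^[k] G)
        (Matrix.vecCons τ x))
      (((fun f : (Fin (m + 1) → ℝ) → ℝ => fun z => fderiv ℝ f z (Pi.single 0 1))^[k + 1] G)
        (Matrix.vecCons t x)) t := by
  rw [iterate_succ_apply']
  have h1 := ((analyticOnNhd_iterate_dirDeriv hG k _ ht).differentiableAt).hasFDerivAt
  exact h1.comp_hasDerivAt t (hasDerivAt_vecCons x t)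

/-- **Iterated derivatives of a slice are slices of the iterated directional derivative**: if
`vecCons t x ∈ O` then `iteratedDeriv k (τ ↦ G (vecCons τ x)) t = (∂₀ᵏ G)(vecCons t x)`.
[folklore] -/
theorem iteratedDeriv_slice {O : Set (Fin (m + 1) → ℝ)} {G : (Fin (m + 1) → ℝ) → ℝ}
    (hO : IsOpen O) (hG : AnalyticOnNhd ℝ G O) (k : ℕ) (x : Fin m → ℝ) {t : ℝ}
    (ht : (Matrix.vecCons t x : Fin (m + 1) → ℝ) ∈ O) :
    iteratedDeriv k (fun τ : ℝ => G (Matrix.vecCons τ x)) t =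
      ((fun f : (Fin (m + 1) → ℝ) → ℝ => fun z => fderiv ℝ f z (Pi.single 0 1))^[k] G)
        (Matrix.vecCons t x) := by
  induction k generalizing t with
  | zero => simp
  | succ k ih =>
    rw [iteratedDeriv_succ]
    -- the open set of parameters whose slice point lies in `O`
    have hU : ∀ᶠ τ in 𝓝 t, (Matrix.vecCons τ x : Fin (m + 1) → ℝ) ∈ O :=
      (analyticAt_vecCons_slice x t).continuousAt.preimage_mem_nhds (hO.mem_nhds ht)
    have hev : iteratedDeriv k (fun τ : ℝ => G (Matrix.vecCons τ x)) =ᶠ[𝓝 t]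
        fun τ => ((fun f : (Fin (m + 1) → ℝ) → ℝ => fun z => fderiv ℝ f z (Pi.single 0 1))^[k] G)
          (Matrix.vecCons τ x) :=
      hU.mono fun τ hτ => ih hτ
    rw [hev.deriv_eq]
    exact (hasDerivAt_iterate_dirDeriv_slice hG k x ht).deriv

/-- The slice `τ ↦ G (vecCons τ x)` is smooth at every parameter whose slice point lies in `O`.
[folklore] -/
theorem contDiffAt_slice {O : Set (Fin (m + 1) → ℝ)} {G : (Fin (m + 1) → ℝ) → ℝ}
    (hG : AnalyticOnNhd ℝ G O) (x : Fin m → ℝ) {t : ℝ}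
    (ht : (Matrix.vecCons t x : Fin (m + 1) → ℝ) ∈ O) {n : WithTop ℕ∞} :
    ContDiffAt ℝ n (fun τ : ℝ => G (Matrix.vecCons τ x)) t :=
  ((hG _ ht).comp_of_eq (analyticAt_vecCons_slice x t) rfl).contDiffAt.of_le le_top

/-! ### The uniform Taylor bound -/

/-- **Taylor expansion in the parameter, uniform remainder.** Let `G` be analytic on an open set
`O` containing all slice points `vecCons t x`, `t ∈ [0, δ₀]`, `x ∈ P`, with `P` compact and
`0 < δ₀`. Then for every `K` there is `C` with
`|G (vecCons t x) − Σ_{k ≤ K} (k!)⁻¹ tᵏ (∂₀ᵏ G)(vecCons 0 x)| ≤ C t^{K+1}` for all `t ∈ [0, δ₀]`,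
`x ∈ P`. [folklore] -/
theorem exists_taylor_bound_slice {O : Set (Fin (m + 1) → ℝ)} {G : (Fin (m + 1) → ℝ) → ℝ}
    (hO : IsOpen O) (hG : AnalyticOnNhd ℝ G O) {P : Set (Fin m → ℝ)} (hP : IsCompact P)
    {δ₀ : ℝ} (hδ₀ : 0 < δ₀)
    (hsub : ∀ t ∈ Icc (0 : ℝ) δ₀, ∀ x ∈ P, (Matrix.vecCons t x : Fin (m + 1) → ℝ) ∈ O) (K : ℕ) :
    ∃ C : ℝ, ∀ x ∈ P, ∀ t ∈ Icc (0 : ℝ) δ₀,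
      |G (Matrix.vecCons t x) - ∑ k ∈ Finset.range (K + 1), ((k.factorial : ℝ)⁻¹ * t ^ k) *
        ((fun f : (Fin (m + 1) → ℝ) → ℝ => fun z => fderiv ℝ f z (Pi.single 0 1))^[k] G)
          (Matrix.vecCons 0 x)| ≤ C * t ^ (K + 1) := by
  -- a uniform bound `M` of `∂₀^{K+1} G` on the compact set of slice points
  set D : (Fin (m + 1) → ℝ) → ℝ :=
    ((fun f : (Fin (m + 1) → ℝ) → ℝ => fun z => fderiv ℝ f z (Pi.single 0 1))^[K + 1] G) with hD
  have hKc : IsCompact ((fun p : ℝ × (Fin m → ℝ) => (Matrix.vecCons p.1 p.2 : Fin (m + 1) → ℝ)) ''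
      (Icc (0 : ℝ) δ₀ ×ˢ P)) :=
    (isCompact_Icc.prod hP).image continuous_vecCons₂
  have hKcO : (fun p : ℝ × (Fin m → ℝ) => (Matrix.vecCons p.1 p.2 : Fin (m + 1) → ℝ)) ''
      (Icc (0 : ℝ) δ₀ ×ˢ P) ⊆ O := by
    rintro _ ⟨⟨t, x⟩, ⟨ht, hx⟩, rfl⟩
    exact hsub t ht x hx
  obtain ⟨M, hM⟩ := hKc.exists_bound_of_continuousOn
    ((analyticOnNhd_iterate_dirDeriv hG (K + 1)).continuousOn.mono hKcO)
  refine ⟨M / K.factorial, fun x hx t ht => ?_⟩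
  -- Taylor–Lagrange on the slice through `x`
  set f : ℝ → ℝ := fun τ => G (Matrix.vecCons τ x) with hf
  have hcd : ∀ τ ∈ Icc (0 : ℝ) δ₀, ContDiffAt ℝ ⊤ f τ := fun τ hτ => contDiffAt_slice hG x (hsub τ hτ x hx)
  have hcdo : ContDiffOn ℝ (K + 1) f (Icc 0 δ₀) := fun τ hτ =>
    ((hcd τ hτ).of_le le_top).contDiffWithinAt
  have hwithin : ∀ k, ∀ τ ∈ Icc (0 : ℝ) δ₀, iteratedDerivWithin k f (Icc 0 δ₀) τ =
      ((fun f : (Fin (m + 1) → ℝ) → ℝ => fun z => fderiv ℝ f z (Pi.single 0 1))^[k] G)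
        (Matrix.vecCons τ x) := by
    intro k τ hτ
    rw [iteratedDerivWithin_eq_iteratedDeriv (uniqueDiffOn_Icc hδ₀) ((hcd τ hτ).of_le le_top) hτ]
    exact iteratedDeriv_slice hO hG k x (hsub τ hτ x hx)
  have hbound : ∀ y ∈ Icc (0 : ℝ) δ₀, ‖iteratedDerivWithin (K + 1) f (Icc 0 δ₀) y‖ ≤ M := by
    intro y hy
    rw [hwithin (K + 1) y hy]
    exact hM _ ⟨⟨y, x⟩, ⟨hy, hx⟩, rfl⟩
  have htaylor := taylor_mean_remainder_bound hδ₀.le hcdo ht hbound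
  rw [taylor_within_apply] at htaylor
  have hsum : ∑ k ∈ Finset.range (K + 1), ((k.factorial : ℝ)⁻¹ * (t - 0) ^ k) •
      iteratedDerivWithin k f (Icc 0 δ₀) 0 =
      ∑ k ∈ Finset.range (K + 1), ((k.factorial : ℝ)⁻¹ * t ^ k) *
        ((fun f : (Fin (m + 1) → ℝ) → ℝ => fun z => fderiv ℝ f z (Pi.single 0 1))^[k] G)
          (Matrix.vecCons 0 x) := by
    refine Finset.sum_congr rfl fun k _ => ?_
    rw [sub_zero, smul_eq_mul, hwithin k 0 ⟨le_rfl, hδ₀.le⟩]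
  rw [hsum, Real.norm_eq_abs, sub_zero] at htaylor
  calc _ ≤ M * t ^ (K + 1) / K.factorial := htaylor
    _ = M / K.factorial * t ^ (K + 1) := by ring

/-! ### The coefficient functions -/

/-- The embedding `x ↦ vecCons 0 x` is a `ℚ`-semialgebraic map on any `ℚ`-semialgebraic set.
[folklore] -/
theorem isSemialgebraicMapOn_vecCons_zero {P : Set (Fin m → ℝ)} (hP : IsSemialgebraic ℚ P) :
    IsSemialgebraicMapOn ℚ P fun x : Fin m → ℝ => (Matrix.vecCons 0 x : Fin (m + 1) → ℝ) := by
  refine IsSemialgebraicMapOn.of_forall hP fun j => ?_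
  refine Fin.cases ?_ (fun i => ?_) j
  · simpa using isSemialgebraicFunOn_const_ratCast hP 0
  · simpa using isSemialgebraicFunOn_aeval hP (MvPolynomial.X i)

/-- The Taylor coefficient functions `x ↦ (∂₀ᵏ G)(vecCons 0 x)` are `ℚ`-semialgebraic on every
`ℚ`-semialgebraic `P` whose slice points at `t = 0` lie in `O`. [folklore] -/
theorem isSemialgebraicFunOn_dirDeriv_coeff {O : Set (Fin (m + 1) → ℝ)}
    {G : (Fin (m + 1) → ℝ) → ℝ} (hO : IsOpen O) (hOsa : IsSemialgebraic ℚ O)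
    (hG : AnalyticOnNhd ℝ G O) (hsa : IsSemialgebraicFunOn ℚ O G) (k : ℕ)
    {P : Set (Fin m → ℝ)} (hP : IsSemialgebraic ℚ P)
    (hsub : ∀ x ∈ P, (Matrix.vecCons 0 x : Fin (m + 1) → ℝ) ∈ O) :
    IsSemialgebraicFunOn ℚ P fun x =>
      ((fun f : (Fin (m + 1) → ℝ) → ℝ => fun z => fderiv ℝ f z (Pi.single 0 1))^[k] G)
        (Matrix.vecCons 0 x) := by
  refine IsSemialgebraicFunOn.comp_isSemialgebraicMapOn_holds (t := O)
    ((isSemialgebraicFunOn_iterate_dirDeriv hO hG hsa k).mono Subset.rfl hOsa)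
    (isSemialgebraicMapOn_vecCons_zero hP) ?_
  exact fun x hx => hsub x hx

/-- The Taylor coefficient functions are continuous on `P`. [folklore] -/
theorem continuousOn_dirDeriv_coeff {O : Set (Fin (m + 1) → ℝ)} {G : (Fin (m + 1) → ℝ) → ℝ}
    (hG : AnalyticOnNhd ℝ G O) (k : ℕ) {P : Set (Fin m → ℝ)}
    (hsub : ∀ x ∈ P, (Matrix.vecCons 0 x : Fin (m + 1) → ℝ) ∈ O) :
    ContinuousOn (fun x =>
      ((fun f : (Fin (m + 1) → ℝ) → ℝ => fun z => fderiv ℝ f z (Pi.single 0 1))^[k] G)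
        (Matrix.vecCons 0 x)) P := by
  refine ((analyticOnNhd_iterate_dirDeriv hG k).continuousOn).comp
    (Literature.NumberTheory.Transcendental.KZ.continuous_vecCons 0).continuousOn hsub

/-- The Taylor coefficient functions are analytic at every point of `P` (slices of the analytic
`∂₀ᵏ G` along the analytic embedding `x ↦ vecCons 0 x`). [folklore] -/
theorem analyticAt_dirDeriv_coeff {O : Set (Fin (m + 1) → ℝ)} {G : (Fin (m + 1) → ℝ) → ℝ}
    (hG : AnalyticOnNhd ℝ G O) (k : ℕ) {x : Fin m → ℝ}
    (hx : (Matrix.vecCons 0 x : Fin (m + 1) → ℝ) ∈ O) :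
    AnalyticAt ℝ (fun x : Fin m → ℝ =>
      ((fun f : (Fin (m + 1) → ℝ) → ℝ => fun z => fderiv ℝ f z (Pi.single 0 1))^[k] G)
        (Matrix.vecCons 0 x)) x := by
  have hlin : AnalyticAt ℝ (fun x : Fin m → ℝ => (Matrix.vecCons 0 x : Fin (m + 1) → ℝ)) x := by
    refine analyticAt_pi_iff.mpr fun j => ?_
    refine Fin.cases ?_ (fun i => ?_) j
    · simpa using analyticAt_const
    · have h : AnalyticAt ℝ (fun y : Fin m → ℝ => y i) x :=
        (ContinuousLinearMap.proj (R := ℝ) (φ := fun _ : Fin m => ℝ) i).analyticAt x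
      simpa using h
  exact (analyticOnNhd_iterate_dirDeriv hG k _ hx).comp hlin

end Summit.KontsevichZagierPeriods.ValuedFieldSpecialisation
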